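import Summits.Schanuel.Schanuel.Theorems.ZilberEacFermatSurface
import Literature.ModelTheory.Zilber.EACDensityQuestion
import HarnessLib

/-!
# The Fermat surfaces are in Mantova–Masser's case (dim-π-S-1-free), with free torus part

Zilber's Exponential-Algebraic Closedness, case ladder (host summit Schanuel, cell `pub-schanuel`,
seat 2, gen 5).  CERTIFICATE accompanying `ZilberEacFermatDensity`: for every `N ≥ 2` the Fermat
surface `S_N = {x₀ᴺ + x₁ᴺ = 1, y₀ + y₁ = 1} ⊆ ℂ² × ℂ²` satisfies all five hypotheses
`MMCaseDimPiOneFree` of Mantova–Masser's case (dim-π-S-1-free) [MantovaMasser2023, Thm. 1.2, p. 4]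
(irreducible surface meeting the torus, `dim S_N = 2`, `dim cl π(S_N ∩ G²) = 1`, and
`cl π(S_N ∩ G²)` — the affine Fermat curve — is not a line of rational slope), AND its torus part is
multiplicatively free (`y₀ᵃ y₁ᵇ` is constant on `{y₀ + y₁ = 1}` only for `a = b = 0`: evaluate at
`y₀ = 2, -1, 1/2` and compare absolute values).  So `S_N` is an instance of the REPAIRED (free) density
question, decided YES in `ZilberEacFermatDensity`.

* `irreducible_fermatCurvePoly`, `zariskiDim_fermatCurve` (`= 1`), `not_isRationalSlopeLine_fermatCurve`;
* `projAdd_image_fermatSurface` (`π(S_N ∩ G²)` is the whole Fermat curve: `y = (2, -1)` is available);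
* `zariskiDim_fermatSurface` (`= 2`: `x̄₀, ȳ₀` are algebraically independent), `addProjDim_fermatSurface`;
* `isMulFree_fermatSurface`, `mmCase_fermatSurface`.

HONEST FRAMING: routine verifications; `EC(3,2)` OPEN; nothing here bears on Schanuel's conjecture.
-/

noncomputable section

open MvPolynomial Complex
open Literature.NumberTheory.Transcendental Literature.ModelTheory.Zilber

set_option linter.dupNamespace false

namespace Summit.Schanuel.Schanuel.Theorems

/-! ## The affine Fermat curve `x₀ᴺ + x₁ᴺ = 1 ⊆ ℂ²` -/

/-- `x₀ᴺ + x₁ᴺ - 1` is irreducible in `ℂ[x₀, x₁]` (`N ≥ 1`). [folklore] -/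
theorem irreducible_fermatCurvePoly {N : ℕ} (hN : 1 ≤ N) :
    Irreducible ((X 0 : MvPolynomial (Fin 2) ℂ) ^ N + X 1 ^ N - 1) := by
  set e : Option (Fin 1) ≃ Fin 2 := (finSuccEquiv 1).symm with he
  have he0 : e none = 0 := by rw [he]; decide
  have he1 : e (some 0) = 1 := by rw [he]; decide
  have h1 := irreducible_X_pow_add_C_X_pow_sub_one (0 : Fin 1) hN
  set E₁ := (optionEquivLeft ℂ (Fin 1)).symm
  set E₂ := renameEquiv ℂ e
  have h2 : E₂ (E₁ (Polynomial.X ^ N + Polynomial.C ((X 0 : MvPolynomial (Fin 1) ℂ) ^ N - 1))) =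
      (X 0 : MvPolynomial (Fin 2) ℂ) ^ N + X 1 ^ N - 1 := by
    simp only [E₁, E₂, map_add, map_sub, map_pow, map_one, optionEquivLeft_symm_X,
      optionEquivLeft_symm_C_X, renameEquiv_apply, rename_X, he0, he1]
    ring
  rw [← h2, MulEquiv.irreducible_iff, MulEquiv.irreducible_iff]
  exact h1

/-- The Fermat curve is `Z(x₀ᴺ + x₁ᴺ - 1)`. [folklore] -/
theorem fermatCurve_eq_zeroLocus (N : ℕ) :
    {x : Fin 2 → ℂ | x 0 ^ N + x 1 ^ N = 1} =
      zeroLocus ℂ (Ideal.span {((X 0 : MvPolynomial (Fin 2) ℂ) ^ N + X 1 ^ N - 1)}) := by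
  rw [zeroLocus_span]
  ext x
  simp only [Set.mem_setOf_eq, Set.mem_singleton_iff, forall_eq, map_sub, map_add, map_pow, aeval_X,
    map_one, sub_eq_zero]

/-- Every `a ∈ ℂ` is the first coordinate of a point of the Fermat curve (`N ≥ 1`). [folklore] -/
theorem exists_mem_fermatCurve {N : ℕ} (hN : 1 ≤ N) (a : ℂ) : ∃ c : ℂ, a ^ N + c ^ N = 1 := by
  obtain ⟨c, hc⟩ := IsAlgClosed.exists_pow_nat_eq (1 - a ^ N) (by omega : 0 < N)
  exact ⟨c, by rw [hc]; ring⟩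

/-- **The Fermat curve has dimension `1`** (`N ≥ 1`). [folklore] -/
theorem zariskiDim_fermatCurve {N : ℕ} (hN : 1 ≤ N) :
    zariskiDim ℂ {x : Fin 2 → ℂ | x 0 ^ N + x 1 ^ N = 1} = (1 : ℕ) := by
  classical
  set g : MvPolynomial (Fin 2) ℂ := X 0 ^ N + X 1 ^ N - 1 with hg
  haveI hprime : (Ideal.span {g}).IsPrime :=
    (Ideal.span_singleton_prime (irreducible_fermatCurvePoly hN).ne_zero).2
      (irreducible_fermatCurvePoly hN).prime
  rw [fermatCurve_eq_zeroLocus, zariskiDim_zeroLocus_eq_trdeg (Ideal.span {g})]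
  set Q := MvPolynomial (Fin 2) ℂ ⧸ Ideal.span {g}
  haveI : IsDomain Q := Ideal.Quotient.isDomain _
  set x : Fin 2 → Q := fun v => Ideal.Quotient.mk (Ideal.span {g}) (X v) with hx
  have hrel : x 1 ^ N = 1 - x 0 ^ N := by
    have h : Ideal.Quotient.mk (Ideal.span {g}) g = 0 :=
      Ideal.Quotient.eq_zero_iff_mem.2 (Ideal.subset_span rfl)
    simp only [hg, map_sub, map_add, map_pow, map_one] at h
    rw [hx]; linear_combination h
  -- upper bound: `Q` integral over `ℂ[x̄₀]`
  set s₀ : Set Q := {x 0} with hs₀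
  set K₀ := Algebra.adjoin ℂ s₀ with hK₀
  have hx0 : x 0 ∈ K₀ := Algebra.subset_adjoin (by simp [hs₀])
  have h0 : IsIntegral K₀ (x 0) := isIntegral_algebraMap (A := Q) (x := (⟨x 0, hx0⟩ : K₀))
  have hcK : 1 - x 0 ^ N ∈ K₀ := K₀.sub_mem K₀.one_mem (K₀.pow_mem hx0 N)
  have h1 : IsIntegral K₀ (x 1) := by
    refine ⟨Polynomial.X ^ N - Polynomial.C ⟨1 - x 0 ^ N, hcK⟩,
      Polynomial.monic_X_pow_sub_C _ (by omega), ?_⟩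
    rw [Polynomial.eval₂_sub, Polynomial.eval₂_X_pow, Polynomial.eval₂_C]
    change x 1 ^ N - (1 - x 0 ^ N) = 0
    rw [hrel, sub_self]
  have hgen : ∀ v, IsIntegral K₀ (x v) := by
    intro v; fin_cases v
    exacts [h0, h1]
  have htop : Algebra.adjoin ℂ (Set.range x) = ⊤ := by
    have h1 : Algebra.adjoin ℂ (Set.range x) =
        (Algebra.adjoin ℂ (Set.range (X : Fin 2 → MvPolynomial (Fin 2) ℂ))).map
          (Ideal.Quotient.mkₐ ℂ (Ideal.span {g})) := by
      rw [AlgHom.map_adjoin, ← Set.range_comp]; rfl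
    rw [h1, MvPolynomial.adjoin_range_X, Algebra.map_top, AlgHom.range_eq_top]
    exact Ideal.Quotient.mkₐ_surjective ℂ _
  haveI hint : Algebra.IsIntegral K₀ Q := by
    refine ⟨fun q => ?_⟩
    have hq : q ∈ Algebra.adjoin ℂ (Set.range x) := by rw [htop]; exact Algebra.mem_top
    have hle : Algebra.adjoin ℂ (Set.range x) ≤ (integralClosure K₀ Q).restrictScalars ℂ := by
      refine Algebra.adjoin_le ?_
      rintro _ ⟨v, rfl⟩
      exact hgen v
    exact hle hq
  haveI : Algebra.IsAlgebraic K₀ Q := ⟨fun q => (hint.isIntegral q).isAlgebraic⟩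
  have hup : Algebra.trdeg ℂ Q ≤ 1 := by
    have := Algebra.IsAlgebraic.trdeg_le_cardinalMk ℂ s₀
    rwa [hs₀, Cardinal.mk_singleton] at this
  -- lower bound: `x̄₀` is transcendental
  have hind : AlgebraicIndependent ℂ ![x 0] := by
    rw [algebraicIndependent_iff]
    intro p hp
    -- `aeval ![x̄₀] p = mk (rename (fun _ => 0) p)`
    have hcomp : aeval ![x 0] p =
        Ideal.Quotient.mk (Ideal.span {g}) (rename (fun _ : Fin 1 => (0 : Fin 2)) p) := by
      have : (aeval ![x 0] : MvPolynomial (Fin 1) ℂ →ₐ[ℂ] Q) =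
          (Ideal.Quotient.mkₐ ℂ (Ideal.span {g})).comp (rename fun _ : Fin 1 => (0 : Fin 2)) := by
        refine MvPolynomial.algHom_ext fun i => ?_
        fin_cases i
        simp only [aeval_X, AlgHom.comp_apply, rename_X, Ideal.Quotient.mkₐ_eq_mk]
        rfl
      rw [this]; rfl
    rw [hcomp, Ideal.Quotient.eq_zero_iff_mem] at hp
    -- so `rename _ p` vanishes on the curve, hence `p(a) = 0` for every `a`
    have hvan : rename (fun _ : Fin 1 => (0 : Fin 2)) p ∈
        vanishingIdeal ℂ {x : Fin 2 → ℂ | x 0 ^ N + x 1 ^ N = 1} := by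
      rw [fermatCurve_eq_zeroLocus, MvPolynomial.IsPrime.vanishingIdeal_zeroLocus]; exact hp
    rw [mem_vanishingIdeal_iff] at hvan
    apply MvPolynomial.funext
    intro a
    obtain ⟨c, hc⟩ := exists_mem_fermatCurve hN (a 0)
    have h := hvan ![a 0, c] (by simpa using hc)
    rw [aeval_rename] at h
    have ha : (![a 0, c] ∘ fun _ : Fin 1 => (0 : Fin 2)) = a := by
      funext i; fin_cases i; rfl
    rw [ha] at h
    rw [map_zero]
    exact h
  have hlow : 1 ≤ Algebra.trdeg ℂ Q := by
    have := hind.cardinalMk_le_trdeg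
    simpa using this
  have hfin : Algebra.trdeg ℂ Q < Cardinal.aleph0 := hup.trans_lt (by exact Cardinal.natCast_lt_aleph0)
  have h1' : Cardinal.toNat (Algebra.trdeg ℂ Q) = 1 := by
    apply le_antisymm
    · simpa using Cardinal.toNat_le_toNat hup (by exact Cardinal.natCast_lt_aleph0)
    · simpa using Cardinal.toNat_le_toNat hlow hfin
  rw [h1']

/-- **The Fermat curve is not a line of rational slope** (`N ≥ 2`): it contains the non-collinear
points `(1, 0)`, `(0, 1)`, `(ζ, 0)` with `ζ = e^{2πi/N} ≠ 1`. [folklore] -/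
theorem not_isRationalSlopeLine_fermatCurve {N : ℕ} (hN : 2 ≤ N) :
    ¬ IsRationalSlopeLine {x : Fin 2 → ℂ | x 0 ^ N + x 1 ^ N = 1} := by
  rintro ⟨m, hm, c, hS⟩
  have hN0 : N ≠ 0 := by omega
  -- a primitive `N`-th root of unity `ζ ≠ 1`
  set ζ : ℂ := exp (2 * Real.pi * I / N) with hζdef
  have hζ : IsPrimitiveRoot ζ N := Complex.isPrimitiveRoot_exp N hN0
  have hζN : ζ ^ N = 1 := hζ.pow_eq_one
  have hζ1 : ζ ≠ 1 := hζ.ne_one (by omega)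
  have mem : ∀ x : Fin 2 → ℂ, x 0 ^ N + x 1 ^ N = 1 → (m 0 : ℂ) * x 0 + (m 1 : ℂ) * x 1 = c := by
    intro x hx
    have : x ∈ {x : Fin 2 → ℂ | x 0 ^ N + x 1 ^ N = 1} := hx
    rw [hS] at this
    exact this
  have h10 := mem ![1, 0] (by simp [zero_pow hN0])
  have h01 := mem ![0, 1] (by simp [zero_pow hN0])
  have hζ0 := mem ![ζ, 0] (by simp [zero_pow hN0, hζN])
  simp only [Matrix.cons_val_zero, Matrix.cons_val_one, mul_one, mul_zero,
    add_zero, zero_add] at h10 h01 hζ0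
  have hm0 : (m 0 : ℂ) = 0 := by
    have h : (m 0 : ℂ) * (1 - ζ) = 0 := by linear_combination h10 - hζ0
    rcases mul_eq_zero.1 h with h | h
    · exact h
    · exact absurd (sub_eq_zero.1 h).symm hζ1
  have hm1 : (m 1 : ℂ) = 0 := by rw [h01, ← h10, hm0]
  apply hm
  funext i
  fin_cases i
  · exact_mod_cast hm0
  · exact_mod_cast hm1

/-! ## The Fermat surface: torus part, dimension, additive projection, freeness -/

section Surface

variable (N : ℕ)

/-- The point `(1, 0; t, 1 - t)` of the Fermat surface (`N ≥ 1`, in the torus for `t ≠ 0, 1`).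
[folklore] -/
theorem linePoint_mem_fermatSurface (hN : 1 ≤ N) (t : ℂ) :
    (Sum.elim ![1, 0] ![t, 1 - t] : Fin 2 ⊕ Fin 2 → ℂ) ∈
      {s : Fin 2 ⊕ Fin 2 → ℂ | s (Sum.inl 0) ^ N + s (Sum.inl 1) ^ N = 1 ∧
        s (Sum.inr 0) + s (Sum.inr 1) = 1} := by
  simp only [Set.mem_setOf_eq, Sum.elim_inl, Sum.elim_inr, Matrix.cons_val_zero, Matrix.cons_val_one,
    one_pow, zero_pow (by omega : N ≠ 0), add_zero, add_sub_cancel, and_self]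

/-- `(x; 2, -1)` lies in the torus part of the Fermat surface for every `x` on the Fermat curve.
[folklore] -/
theorem curvePoint_mem_fermatSurface_inter_torusLocus {x : Fin 2 → ℂ} (hx : x 0 ^ N + x 1 ^ N = 1) :
    (Sum.elim x ![2, -1] : Fin 2 ⊕ Fin 2 → ℂ) ∈
      {s : Fin 2 ⊕ Fin 2 → ℂ | s (Sum.inl 0) ^ N + s (Sum.inl 1) ^ N = 1 ∧
        s (Sum.inr 0) + s (Sum.inr 1) = 1} ∩ torusLocus ℂ 2 := by
  refine ⟨?_, ?_⟩
  · simp only [Set.mem_setOf_eq, Sum.elim_inl, Sum.elim_inr, Matrix.cons_val_zero, Matrix.cons_val_one]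
    exact ⟨hx, by norm_num⟩
  · rw [mem_torusLocus_iff]
    intro i
    fin_cases i <;> simp

/-- The torus part of the Fermat surface is non-empty (`N ≥ 1`). [folklore] -/
theorem fermatSurface_inter_torusLocus_nonempty (hN : 1 ≤ N) :
    ({s : Fin 2 ⊕ Fin 2 → ℂ | s (Sum.inl 0) ^ N + s (Sum.inl 1) ^ N = 1 ∧
        s (Sum.inr 0) + s (Sum.inr 1) = 1} ∩ torusLocus ℂ 2).Nonempty :=
  ⟨_, curvePoint_mem_fermatSurface_inter_torusLocus N (x := ![1, 0])
    (by simp [zero_pow (by omega : N ≠ 0)])⟩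

/-- **The additive projection of the torus part is the whole Fermat curve.** [folklore] -/
theorem projAdd_image_fermatSurface (hN : 1 ≤ N) :
    projAdd '' ({s : Fin 2 ⊕ Fin 2 → ℂ | s (Sum.inl 0) ^ N + s (Sum.inl 1) ^ N = 1 ∧
        s (Sum.inr 0) + s (Sum.inr 1) = 1} ∩ torusLocus ℂ 2) =
      {x : Fin 2 → ℂ | x 0 ^ N + x 1 ^ N = 1} := by
  have _ := hN
  ext x
  constructor
  · rintro ⟨s, ⟨hs, -⟩, rfl⟩
    exact hs.1
  · intro hx
    exact ⟨_, curvePoint_mem_fermatSurface_inter_torusLocus N hx, by funext i; rfl⟩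

/-- **`addProjDim S_N = 1`** (`N ≥ 1`). [folklore] -/
theorem addProjDim_fermatSurface (hN : 1 ≤ N) :
    addProjDim ℂ 2 {s : Fin 2 ⊕ Fin 2 → ℂ | s (Sum.inl 0) ^ N + s (Sum.inl 1) ^ N = 1 ∧
      s (Sum.inr 0) + s (Sum.inr 1) = 1} = (1 : ℕ) := by
  rw [addProjDim, projAdd_image_fermatSurface N hN, zariskiDim_fermatCurve hN]

/-- **`dim S_N = 2`** (`N ≥ 1`): `≤ 2` by `zariskiDim_fermatSurface_le`, `≥ 2` since `x̄₀, ȳ₀` are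
algebraically independent in the coordinate ring (`S_N` surjects onto `ℂ²_{x₀, y₀}`). [folklore] -/
theorem zariskiDim_fermatSurface (hN : 1 ≤ N) :
    zariskiDim ℂ {s : Fin 2 ⊕ Fin 2 → ℂ | s (Sum.inl 0) ^ N + s (Sum.inl 1) ^ N = 1 ∧
      s (Sum.inr 0) + s (Sum.inr 1) = 1} = (2 : ℕ) := by
  classical
  refine le_antisymm (zariskiDim_fermatSurface_le N hN) ?_
  set S := {s : Fin 2 ⊕ Fin 2 → ℂ | s (Sum.inl 0) ^ N + s (Sum.inl 1) ^ N = 1 ∧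
      s (Sum.inr 0) + s (Sum.inr 1) = 1} with hSdef
  have hS := isIrreducibleClosed_fermatSurface N hN
  set I := vanishingIdeal ℂ S with hI
  haveI : I.IsPrime := hS.2
  have hSZ : S = zeroLocus ℂ I := eq_zeroLocus_vanishingIdeal_of_isZariskiClosed hS.1
  rw [hSZ, zariskiDim_zeroLocus_eq_trdeg I]
  set Q := MvPolynomial (Fin 2 ⊕ Fin 2) ℂ ⧸ I
  haveI : IsDomain Q := Ideal.Quotient.isDomain I
  -- the two independent coordinate functions
  set ι : Fin 2 → Fin 2 ⊕ Fin 2 := ![Sum.inl 0, Sum.inr 0] with hι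
  have hind : AlgebraicIndependent ℂ (fun i => Ideal.Quotient.mk I (X (ι i))) := by
    rw [algebraicIndependent_iff]
    intro p hp
    have hcomp : aeval (fun i => Ideal.Quotient.mk I (X (ι i))) p =
        Ideal.Quotient.mk I (rename ι p) := by
      have : (aeval (fun i => Ideal.Quotient.mk I (X (ι i))) : MvPolynomial (Fin 2) ℂ →ₐ[ℂ] Q) =
          (Ideal.Quotient.mkₐ ℂ I).comp (rename ι) := by
        refine MvPolynomial.algHom_ext fun i => ?_
        simp only [aeval_X, AlgHom.comp_apply, rename_X, Ideal.Quotient.mkₐ_eq_mk]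
      rw [this]; rfl
    rw [hcomp, Ideal.Quotient.eq_zero_iff_mem, hI, mem_vanishingIdeal_iff] at hp
    apply MvPolynomial.funext
    intro a
    obtain ⟨c, hc⟩ := exists_mem_fermatCurve hN (a 0)
    -- the point `(a₀, c; a₁, 1 - a₁)` of `S`
    have hmem : (Sum.elim ![a 0, c] ![a 1, 1 - a 1] : Fin 2 ⊕ Fin 2 → ℂ) ∈ S := by
      simp only [hSdef, Set.mem_setOf_eq, Sum.elim_inl, Sum.elim_inr, Matrix.cons_val_zero,
        Matrix.cons_val_one, add_sub_cancel, and_true]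
      exact hc
    have h := hp _ hmem
    rw [aeval_rename] at h
    have ha : ((Sum.elim ![a 0, c] ![a 1, 1 - a 1] : Fin 2 ⊕ Fin 2 → ℂ) ∘ ι) = a := by
      funext i; fin_cases i <;> rfl
    rw [ha] at h
    rw [map_zero]
    exact h
  have hlow : 2 ≤ Algebra.trdeg ℂ Q := by
    have := hind.cardinalMk_le_trdeg
    simpa using this
  -- `trdeg` is finite (it is `≤ 2` by the integrality argument of `zariskiDim_fermatSurface_le`)
  haveI : Algebra.FiniteType ℂ Q := Algebra.FiniteType.of_surjective
    (Ideal.Quotient.mkₐ ℂ I) (Ideal.Quotient.mkₐ_surjective ℂ I)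
  have hfin : Algebra.trdeg ℂ Q < Cardinal.aleph0 := trdeg_lt_aleph0
  have h2 : 2 ≤ Cardinal.toNat (Algebra.trdeg ℂ Q) := by
    simpa using Cardinal.toNat_le_toNat hlow hfin
  exact_mod_cast h2

/-- **The torus part of the Fermat surface is multiplicatively free** (`N ≥ 1`): if `y₀ᵃ y₁ᵇ = c` on
it, evaluating at the points `(1, 0; t, 1 - t)`, `t = 2, -1, 1/2`, and taking absolute values gives
`2ᵃ = 2ᵇ = 2^{-(a+b)}`, so `a = b = 0`. [folklore] -/
theorem isMulFree_fermatSurface (hN : 1 ≤ N) :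
    IsMulFree ℂ 2 ({s : Fin 2 ⊕ Fin 2 → ℂ | s (Sum.inl 0) ^ N + s (Sum.inl 1) ^ N = 1 ∧
      s (Sum.inr 0) + s (Sum.inr 1) = 1} ∩ torusLocus ℂ 2) := by
  rintro m hm ⟨c, hc⟩
  -- the value of the monomial at `(1, 0; t, 1 - t)`
  have hval : ∀ t : ℂ, t ≠ 0 → t ≠ 1 → t ^ m 0 * (1 - t) ^ m 1 = c := by
    intro t ht0 ht1
    have hmem : (Sum.elim ![1, 0] ![t, 1 - t] : Fin 2 ⊕ Fin 2 → ℂ) ∈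
        {s : Fin 2 ⊕ Fin 2 → ℂ | s (Sum.inl 0) ^ N + s (Sum.inl 1) ^ N = 1 ∧
          s (Sum.inr 0) + s (Sum.inr 1) = 1} ∩ torusLocus ℂ 2 := by
      refine ⟨linePoint_mem_fermatSurface N hN t, ?_⟩
      rw [mem_torusLocus_iff]
      intro i
      fin_cases i
      · simpa using ht0
      · simpa [sub_eq_zero] using fun h => ht1 h.symm
    have h := hc _ hmem
    rw [Fin.prod_univ_two] at h
    simpa using h
  have h2 := hval 2 (by norm_num) (by norm_num)
  have hm1 := hval (-1) (by norm_num) (by norm_num)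
  have hh := hval (1 / 2) (by norm_num) (by norm_num)
  -- absolute values
  have n2 : ‖c‖ = (2 : ℝ) ^ m 0 := by
    rw [← h2, norm_mul, norm_zpow, norm_zpow]; norm_num
  have nm1 : ‖c‖ = (2 : ℝ) ^ m 1 := by
    rw [← hm1, norm_mul, norm_zpow, norm_zpow]; norm_num
  have nh : ‖c‖ = (2 : ℝ) ^ (-(m 0 + m 1)) := by
    rw [← hh, norm_mul, norm_zpow, norm_zpow, zpow_neg, zpow_add₀ (by norm_num : (2 : ℝ) ≠ 0)]
    norm_num
    rw [one_div, inv_zpow, inv_zpow, mul_comm]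
  have e1 : m 0 = m 1 := (zpow_right_inj₀ (by norm_num : (0 : ℝ) < 2) (by norm_num)).1 (n2 ▸ nm1)
  have e2 : m 0 = -(m 0 + m 1) :=
    (zpow_right_inj₀ (by norm_num : (0 : ℝ) < 2) (by norm_num)).1 (n2 ▸ nh)
  apply hm
  funext i
  fin_cases i
  · change m 0 = 0; omega
  · change m 1 = 0; omega

/-- **The Fermat surface is in Mantova–Masser's case (dim-π-S-1-free)** (`N ≥ 2`).
[cite: MantovaMasser2023, Thm. 1.2 case (dim-pi-S-1-free), p. 4] -/
theorem mmCase_fermatSurface (hN : 2 ≤ N) :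
    MMCaseDimPiOneFree {s : Fin 2 ⊕ Fin 2 → ℂ | s (Sum.inl 0) ^ N + s (Sum.inl 1) ^ N = 1 ∧
      s (Sum.inr 0) + s (Sum.inr 1) = 1} := by
  have hN1 : 1 ≤ N := by omega
  refine ⟨isIrreducibleClosed_fermatSurface N hN1, fermatSurface_inter_torusLocus_nonempty N hN1,
    zariskiDim_fermatSurface N hN1, addProjDim_fermatSurface N hN1, ?_⟩
  rw [projAdd_image_fermatSurface N hN1]
  have hcl : zeroLocus ℂ (vanishingIdeal ℂ {x : Fin 2 → ℂ | x 0 ^ N + x 1 ^ N = 1}) =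
      {x : Fin 2 → ℂ | x 0 ^ N + x 1 ^ N = 1} :=
    (eq_zeroLocus_vanishingIdeal_of_isZariskiClosed ⟨_, fermatCurve_eq_zeroLocus N⟩).symm
  rw [hcl]
  exact not_isRationalSlopeLine_fermatCurve hN

end Surface

end Summit.Schanuel.Schanuel.Theorems
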